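import Mathlib.Analysis.Normed.Module.Basic
import Mathlib.Analysis.SpecialFunctions.Complex.Circle
import Mathlib.Tactic.Module
import HarnessLib

/-!
# van Dam–Seroussi, Fact 2: reading a relative phase off one qubit (exact and robust forms)

Topic `Literature/Computability/Cryptography`, companion of `VanDamSeroussiGaussSums.lean` (the named
fact `VanDamSeroussi2002_gaussSumPhase_qsolvable`). [VanDamSeroussi2002, §3.1 Fact 2]: "Let `γ` be an
unknown phase of the qubit `|x_γ⟩ = (|0⟩ + e^{iγ}|1⟩)/√2`. If we measure this qubit in the basis
`|m_φ⟩ = (|0⟩ + e^{iφ}|1⟩)/√2`, `|m_φ^⊥⟩`, then `Prob(m_φ | x_γ) = 1/2 + cos(γ − φ)/2`", used in the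
proof of Thm. 1 on the state `(|∅⟩ + e^{iγ}|χ⟩)/√2`. In the tree's planned realisation (NOTES of the
`provefact` unit: a control qubit `s`, the two branches returning to the SAME clean register state
`ψ` with phases `e^{iα}` (the Gauss-sum eigenvalue of Algorithm 1) and `e^{iβ}` (a reference branch
with known phase), then a Hadamard on `s`), the amplitude vector of the outcome `s = 0` is
`(a₀ + a₁)/2` where `a_s` is the final state of branch `s`. This file PROVES the vector-space content,
in any complex normed space:

* `norm_sq_half_exp_add_exp_smul` — the exact law: for a unit vector `ψ`,
  `‖((e^{iα} + e^{iβ})/2) • ψ‖² = (1 + cos(α − β))/2`;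
* `abs_norm_sq_sub_norm_sq_le` — `|‖w‖² − ‖v‖²| ≤ ‖w − v‖ (2‖v‖ + ‖w − v‖)`;
* **`abs_norm_sq_half_add_sub_le`** — the robust law: if `‖a₀ − e^{iα}ψ‖ ≤ ε₀` and
  `‖a₁ − e^{iβ}ψ‖ ≤ ε₁` then `|‖(a₀ + a₁)/2‖² − (1 + cos(α − β))/2| ≤ δ(2 + δ)` with `δ = (ε₀ + ε₁)/2`
  (so `≤ 3(ε₀ + ε₁)/2` once `ε₀ + ε₁ ≤ 2`).

Everything here is proved; no definition and no named fact is introduced.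

## References

* W. van Dam, G. Seroussi, *Efficient quantum algorithms for estimating Gauss sums*,
  arXiv:quant-ph/0207131 (2002), §3.1 Fact 2, §4 Theorem 1 (proof) [VanDamSeroussi2002].
* M. A. Nielsen, I. L. Chuang, *Quantum Computation and Quantum Information*, CUP 2010, §5.2.1
  (single-qubit phase read-out / Hadamard test) [NielsenChuang2010].
-/

noncomputable section

namespace Literature.Computability.Cryptography

namespace VanDamSeroussi

open Complex

variable {E : Type*} [NormedAddCommGroup E]

/-- `|‖w‖² − ‖v‖²| ≤ ‖w − v‖ (2‖v‖ + ‖w − v‖)`. [folklore] -/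
theorem abs_norm_sq_sub_norm_sq_le (w v : E) : |‖w‖ ^ 2 - ‖v‖ ^ 2| ≤ ‖w - v‖ * (2 * ‖v‖ + ‖w - v‖) := by
  have h1 : |‖w‖ - ‖v‖| ≤ ‖w - v‖ := abs_norm_sub_norm_le w v
  have h2 : ‖w‖ ≤ ‖v‖ + ‖w - v‖ := by
    have := norm_add_le v (w - v); rwa [add_sub_cancel] at this
  rw [sq_sub_sq, abs_mul]
  calc |‖w‖ + ‖v‖| * |‖w‖ - ‖v‖| ≤ (2 * ‖v‖ + ‖w - v‖) * ‖w - v‖ := by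
        apply mul_le_mul _ h1 (abs_nonneg _) (by positivity)
        rw [abs_of_nonneg (by positivity)]; linarith
    _ = ‖w - v‖ * (2 * ‖v‖ + ‖w - v‖) := by ring

variable [NormedSpace ℂ E]

/-- `|e^{iα} + e^{iβ}|² = 2 + 2 cos(α − β)`. [folklore] -/
theorem normSq_exp_add_exp (α β : ℝ) :
    Complex.normSq (Complex.exp (α * I) + Complex.exp (β * I)) = 2 + 2 * Real.cos (α - β) := by
  rw [Complex.normSq_add]
  have h1 : Complex.normSq (Complex.exp (α * I)) = 1 := by
    rw [Complex.normSq_eq_norm_sq, Complex.norm_exp_ofReal_mul_I, one_pow]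
  have h2 : Complex.normSq (Complex.exp (β * I)) = 1 := by
    rw [Complex.normSq_eq_norm_sq, Complex.norm_exp_ofReal_mul_I, one_pow]
  have h3 : (Complex.exp (α * I) * (starRingEnd ℂ) (Complex.exp (β * I))).re = Real.cos (α - β) := by
    rw [← Complex.exp_conj, map_mul, Complex.conj_ofReal, Complex.conj_I, mul_neg, ← Complex.exp_add,
      show (α : ℂ) * I + -(β * I) = ((α - β : ℝ) : ℂ) * I by push_cast; ring,
      Complex.exp_ofReal_mul_I_re]
  rw [h1, h2, h3]; ring

/-- **Fact 2, exact form** [VanDamSeroussi2002, §3.1]: for a unit vector `ψ`,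
`‖((e^{iα} + e^{iβ})/2) • ψ‖² = (1 + cos(α − β))/2` — the probability of reading the control qubit
as `0` after the Hadamard when the two branches carry the phases `e^{iα}`, `e^{iβ}` on the same
state. [cite: VanDamSeroussi2002, §3.1 Fact 2] -/
theorem norm_sq_half_exp_add_exp_smul (α β : ℝ) {ψ : E} (hψ : ‖ψ‖ = 1) :
    ‖((Complex.exp (α * I) + Complex.exp (β * I)) / 2) • ψ‖ ^ 2 = (1 + Real.cos (α - β)) / 2 := by
  rw [norm_smul, hψ, mul_one, norm_div, div_pow, ← Complex.normSq_eq_norm_sq, normSq_exp_add_exp]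
  norm_num
  ring

/-- **Fact 2, robust form**: if the two branch states are within `ε₀`, `ε₁` of `e^{iα}ψ`, `e^{iβ}ψ`
for a unit vector `ψ`, then the probability `‖(a₀ + a₁)/2‖²` of reading the control qubit as `0` is
within `δ(2 + δ)`, `δ = (ε₀ + ε₁)/2`, of `(1 + cos(α − β))/2`. [cite: VanDamSeroussi2002, §3.1 Fact 2 and §4 Thm. 1 (proof)] -/
theorem abs_norm_sq_half_add_sub_le (α β : ℝ) {ψ a₀ a₁ : E} (hψ : ‖ψ‖ = 1) {ε₀ ε₁ : ℝ}
    (h₀ : ‖a₀ - Complex.exp (α * I) • ψ‖ ≤ ε₀) (h₁ : ‖a₁ - Complex.exp (β * I) • ψ‖ ≤ ε₁) :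
    |‖((1 : ℂ) / 2) • (a₀ + a₁)‖ ^ 2 - (1 + Real.cos (α - β)) / 2| ≤
      (ε₀ + ε₁) / 2 * (2 + (ε₀ + ε₁) / 2) := by
  set v : E := ((Complex.exp (α * I) + Complex.exp (β * I)) / 2) • ψ with hv
  set w : E := ((1 : ℂ) / 2) • (a₀ + a₁) with hw
  have hvn : ‖v‖ ≤ 1 := by
    have := norm_sq_half_exp_add_exp_smul α β hψ
    rw [← hv] at this
    have hc : Real.cos (α - β) ≤ 1 := Real.cos_le_one _
    nlinarith [norm_nonneg v]
  have hwv : ‖w - v‖ ≤ (ε₀ + ε₁) / 2 := by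
    have : w - v = ((1 : ℂ) / 2) • ((a₀ - Complex.exp (α * I) • ψ) + (a₁ - Complex.exp (β * I) • ψ)) := by
      rw [hw, hv]
      module
    rw [this, norm_smul]
    calc ‖((1 : ℂ) / 2)‖ * ‖(a₀ - Complex.exp (α * I) • ψ) + (a₁ - Complex.exp (β * I) • ψ)‖
        ≤ (1 / 2) * (ε₀ + ε₁) := by
          apply mul_le_mul _ ((norm_add_le _ _).trans (add_le_add h₀ h₁)) (norm_nonneg _) (by norm_num)
          simp
      _ = (ε₀ + ε₁) / 2 := by ring
  have hε : 0 ≤ (ε₀ + ε₁) / 2 := le_trans (norm_nonneg _) hwv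
  rw [← norm_sq_half_exp_add_exp_smul α β hψ, ← hv]
  calc |‖w‖ ^ 2 - ‖v‖ ^ 2| ≤ ‖w - v‖ * (2 * ‖v‖ + ‖w - v‖) := abs_norm_sq_sub_norm_sq_le w v
    _ ≤ (ε₀ + ε₁) / 2 * (2 * 1 + (ε₀ + ε₁) / 2) := by
        apply mul_le_mul hwv _ (by positivity) hε
        linarith
    _ = (ε₀ + ε₁) / 2 * (2 + (ε₀ + ε₁) / 2) := by ring

end VanDamSeroussi

end Literature.Computability.Cryptography

end
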